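import Summits.QuantumFields.YangMills.Theorems.ColdExitSC.Negative.UniformExitFalseOfHeavyTwist

/-!
# RUNG 2 of the heavy-twist wall: a deconfinement TWIST WINDOW ⇒ linear growth of every exit selector ⇒ `¬ UniformExit24` parity-free (file 2 of 3)

Shape of record of the director-ym №24 wall seat (ym-ir-wall-p1; critic's SHARPEN 2026-08-28T07:11:56Z verbatim): `TwistWindowAt r c μ κ ρ` /
class level `TwistWindowSU2 κ ρ` — for `β ≥ β₀`, EVEN `L ≥ 8` and `κ·⌊L/4⌋ ≤ β` the twist ratio is `≤ ρ < 1` (expected instance `TwistWindowSU2 204 (9/10)`,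
assembled by the wall seat from Borgs–Seiler's finite-volume Polyakov infrared bound + reflection positivity + the sector Cauchy–Schwarz; pointer credited
to ym-ir-idea-2 g9).  PROVED here from the window and the core file's S1 theorem: a θ-pure EVEN box is LONG (`pure_even_box_is_long`); the PARITY
LOOPHOLE is closed at the tolerance of record via the landed `BasinRung.basin_step24` (θ-pure at `L` ⇒ `10600θ⁴`-pure at `4L`, even) —
`pure_box_is_long_all`, `selector_linear_growth_SU2` (ALL parities: `L(β) > β/κ` eventually), `tolerance_of_record_clears`
(`10600·(1/24)⁴ < (1 − 9/10)/2`), and the headline `not_uniformExit24_of_window : TwistWindowSU2 κ (9/10) → SimplyConnectedSpace SU(2) → ¬ UniformExit24`.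
Every window this method proves is LINEAR in `N_τ = ⌊L/4⌋`; the physical edge is logarithmic (asymptotic freedom) — see the Extras file's RUNG 3.

HONEST FRAMING: a NEGATIVE / wall theorem about the seed functional of the IR leaf; it proves NOTHING toward `BalabanLadder.IR` (stmt-QuantumFields-19354) or `IRcof`
(stmt-QuantumFields-26930), whose count stays 0/1; the Yang–Mills mass gap (Clay) is NOT proved anywhere in this tree; R4 closes only the conditional finite-𝕋⁴ rung `BalabanLadder.UV`.
-/

set_option autoImplicit false

noncomputable section

open Filter Topology MeasureTheory
open Literature.MathematicalPhysics.QuantumFieldTheory Literature.MathematicalPhysics.QuantumLattice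
open Summit.QuantumFields.YangMills.Cruxes.IR.ColdPurityBridge (coldDefect)
open Summit.QuantumFields.YangMills.Cruxes.IR.ColdPressurePincer (AFToColdPressure IRnsc)
open Summit.QuantumFields.YangMills.Cruxes.IR.BasinRung (ColdExitAt basin_step24)
open Summit.QuantumFields.YangMills.Cruxes.IR.AspectBootstrap (boxDefect coldDefect_eq_boxDefect axisSymmetric tracePositive)
open Summit.QuantumFields.YangMills.Cruxes.IR.PinnedExit96 (PinnedExitAt)
open Summit.QuantumFields.YangMills.Cruxes.OSLegsFromFemtoAndGap.DlrCollarTransfer (LowerBounds)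

namespace Summit.QuantumFields.YangMills.Theorems.ColdExitSC.Negative.HeavyTwist

/-! ## §3b RUNG 2 of the wall — rev 4 shape (= crit-3 07:11:56Z «SHARPEN, corrected: `Even L`, threshold `ρ`» + director-ym №24; pointer credited
to ideator ym-ir-idea-2 g9 O9.4 / g10 O10): a DECONFINEMENT TWIST WINDOW below a length function `ℓ(β)` on EVEN boxes forces the exit selectors of
`E(θ)` to outgrow `ℓ`; at the tolerance of record the parity proviso is removed by the landed quadrupling `basin_step24`.

SHAPE OF RECORD (target of the wall seat `ym-ir-wall-p1`).  `TwistWindowAt r c μ κ ρ : 0 < κ ∧ ρ < 1 ∧ ∃ β₀ ∀ β ≥ β₀ ∀ L ≥ 8, Even L →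
κ·⌊L/4⌋ ≤ β → r_β(L) ≤ ρ` (linear window `ℓ(β) = β/κ`), class level `TwistWindowSU2 κ ρ`; expected instance `TwistWindowSU2 204 (9/10)` as an
ASSEMBLY of kernel-closed pieces (crit-3's pricing, verified by her on the tree): (i) Borgs–Seiler's FINITE-VOLUME infrared bound
`Literature.Barriers.QuantumFields.BorgsSeilerInfraredBoundExplicit_holds` (`Literature/Barriers/QuantumFields/FiniteTemperatureInfraredExplicitProofs.lean`;
statement `HasPolyakovInfraredBound d L₀ ρ (borgsSeilerRate N L₀)`: ∀ EVEN periodic `L ≥ 4`, `(1 − cos pᵢ)·Re Ĝ_L(k) ≤ (1 + 2N/J_E)^{L₀} − 1`), the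
diagonal bound `BorgsSeilerPolyakovDiagonal_holds` (`G_L(0) ≥ 1`; this IS crit-1's 07:19:16Z note (b) «uniform lower bound on G(0)») and
`polyakovCorrelation_posSemidef`; (ii) idea-2 O10's sector Cauchy–Schwarz `IdeaTwoO10.sectorCS` / `oddWeight_ge` / `twistRatio_le` (evidence #46
`O10SectorLRO.lean` e3cb8029558e; `m̂` `Ĉ₀`-odd, `‖m̂‖ ≤ N L²` ⇒ both sectors of `Tr 𝒯₃^L` weigh `≥ η = A(L/2)²/(4N²A(0))`; `f = (1 + 4/β)^{⌊L/4⌋} − 1 ≤ 1/50 ⇒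
η ≥ 1/20 ⇒ |r| ≤ 9/10` on the window `204·⌊L/4⌋ ≤ β`); (iii) S1 BY NAME — idea-9 g3's `TwistCost.half_twist_cost_le_coldDefect` (every compact `G`, central
`z`, `β ≥ 0`, `L ≥ 8`; stated over lit-4's `wilsonFinTorusTwistedPartition`, which `twistedColdZ` IS since rev 4) — LANDED p613382 and CONSUMED here since
rev 5 (`purityTwistBoundAt_of_central`, `purityTwistBoundSU2_holds`: S1 is a theorem); (iv) the typed debts D1 (lattice dictionary `FiniteTemperature.Config 3 T L ↔ FinTorusSite L L L T`), D2 (two-direction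
transfer reading `Tr(Ĉ₃𝒯₀^t) = Tr(Ĉ₀𝒯₃^L)`, slice observables as multiplication operators), D4 (finite Fourier on `(ℤ/L)³`).  No physics stub; EVEN `L`
only (spatial reflection positivity); KNOWN mechanism (BS83 Lemma II.6–II.8, Tomboulis–Yaffe 1985), novelty none, width toward `IR` zero.  Honest: the
window is LINEAR in `N_t` — «our bounds completely fail to produce such a [scaling] behavior» (BS83 §IV) [corpus:paper:doi-10-1007-bf01208780] — the true
`N_{t,c}(β) ≍ e^{3π²β/11}` is RUNG 3 (§3d, no engine).

NEW IN rev 4 (g3).  (a) the window is abstracted to a length function `ℓ` (`TwistWindowBelow`), so RUNG 2 and RUNG 3 share the two-line proofs;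
(b) **PARITY LOOPHOLE CLOSED at the tolerance of record**: by `BasinRung.basin_step24` (LANDED, every compact `G`, `β ≥ 0`: `δᶜ_β(L) ≤ u ≤ 1/24 ⇒
δᶜ_β(4L) ≤ 10600·u⁴`) a `θ`-pure box of ANY parity at `L` gives a `10600θ⁴`-pure box at `4L` — even, with `⌊4L/4⌋ = L`; so for `θ ≤ 1/24` with
`10600·θ⁴ < (1 − ρ)/2` (`θ = 1/24`, `ρ = 9/10`: `0.0320 < 0.05`, `tolerance_of_record_clears`) EVERY exit selector satisfies `ℓ(β) < L(β)` eventually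
(`selector_outgrows_all`; linear: `L(β) > β/κ`, a factor `4` off the even-box constant `4β/κ`) and `¬ UniformExitAtRep r θ` needs NO parity proviso
(`not_uniformExitAtRep_of_window`); for `1/24 < θ < (1 − ρ)/2` the statements stay on even boxes (`selector_outgrows_even`,
`not_uniformEvenExitAtRep_of_window`); (c) the PX-squeeze `unitMap_decay_of_pinnedExit` (§3b′). -/

section Rung2

variable {G : Type} [Group G] [TopologicalSpace G] [IsTopologicalGroup G] [CompactSpace G]
  [MeasurableSpace G] [BorelSpace G]

/-- **Deconfinement twist window below a length function `ℓ`** (route-posited, per rep/twist): for all large `β`, every EVEN cold box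
`L³ × ⌊L/4⌋`, `L ≥ 8`, with `⌊L/4⌋ ≤ ℓ(β)` has twist ratio `≤ ρ < 1`, uniformly in `L`. -/
def TwistWindowBelow (r : LatticeRep G) (c : G) (μ : Fin 4) (ℓ : ℝ → ℝ) (ρ : ℝ) : Prop :=
  ρ < 1 ∧ ∃ β₀ : ℝ, ∀ β : ℝ, β₀ ≤ β → ∀ L : ℕ, 8 ≤ L → Even L → ((L / 4 : ℕ) : ℝ) ≤ ℓ β → twistRatio r c μ β L ≤ ρ

/-- **The linear window — SHAPE OF RECORD** (crit-3 07:11:56Z, №24): slope `κ > 0`, threshold `ρ < 1`, EVEN `L ≥ 8`, `κ·⌊L/4⌋ ≤ β ⇒ r_β(L) ≤ ρ`. -/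
def TwistWindowAt (r : LatticeRep G) (c : G) (μ : Fin 4) (κ ρ : ℝ) : Prop :=
  0 < κ ∧ ρ < 1 ∧ ∃ β₀ : ℝ, ∀ β : ℝ, β₀ ≤ β → ∀ L : ℕ, 8 ≤ L → Even L → κ * ((L / 4 : ℕ) : ℝ) ≤ β → twistRatio r c μ β L ≤ ρ

/-- The linear window is the window below `ℓ(β) = β/κ` (PROVED). -/
theorem twistWindowBelow_of_at (r : LatticeRep G) {c : G} {μ : Fin 4} {κ ρ : ℝ} (hW : TwistWindowAt r c μ κ ρ) :
    TwistWindowBelow r c μ (fun β => β / κ) ρ := by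
  obtain ⟨hκ, hρ, β₀, h⟩ := hW
  refine ⟨hρ, β₀, fun β hβ L hL hE hℓ => h β hβ L hL hE ?_⟩
  have h1 : κ * ((L / 4 : ℕ) : ℝ) ≤ κ * (β / κ) := mul_le_mul_of_nonneg_left hℓ hκ.le
  have h2 : κ * (β / κ) = β := by field_simp
  exact h1.trans h2.le

/-- **Pure EVEN boxes are long (PROVED from S1 + the window):** for `θ < (1 − ρ)/2`, every even `θ`-pure cold box at large `β` has `ℓ(β) < ⌊L/4⌋`. -/
theorem pure_even_box_is_long (r : LatticeRep G) {c : G} {μ : Fin 4} {ℓ : ℝ → ℝ} {ρ : ℝ}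
    (hB : PurityTwistBoundAt r c μ) (hW : TwistWindowBelow r c μ ℓ ρ) {θ : ℝ} (hθ : θ < (1 - ρ) / 2) :
    ∃ β₀ : ℝ, ∀ β : ℝ, β₀ ≤ β → ∀ L : ℕ, 8 ≤ L → Even L → coldDefect r.ρ β L ≤ θ → ℓ β < ((L / 4 : ℕ) : ℝ) := by
  obtain ⟨_, β₀, hW⟩ := hW
  refine ⟨max β₀ 0, fun β hβ L hL hE hδ => ?_⟩
  by_contra hcon
  have h1 := hW β ((le_max_left _ _).trans hβ) L hL hE (not_lt.mp hcon)
  have h2 := hB β ((le_max_right _ _).trans hβ) L hL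
  linarith

/-- **Pure boxes of ANY parity are long at tolerance `θ ≤ 1/24` (PROVED from S1 + the window + the LANDED quadrupling `basin_step24`):**
if `10600·θ⁴ < (1 − ρ)/2` then every `θ`-pure cold box at large `β` has `ℓ(β) < L` — quadruple the box (`4L` is even, `⌊4L/4⌋ = L`). -/
theorem pure_box_is_long_all (r : LatticeRep G) {c : G} {μ : Fin 4} {ℓ : ℝ → ℝ} {ρ : ℝ}
    (hB : PurityTwistBoundAt r c μ) (hW : TwistWindowBelow r c μ ℓ ρ) {θ : ℝ} (hθ24 : θ ≤ 1 / 24)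
    (hθρ : 10600 * θ ^ 4 < (1 - ρ) / 2) :
    ∃ β₀ : ℝ, ∀ β : ℝ, β₀ ≤ β → ∀ L : ℕ, 8 ≤ L → coldDefect r.ρ β L ≤ θ → ℓ β < (L : ℝ) := by
  obtain ⟨β₀, h⟩ := pure_even_box_is_long r hB hW hθρ
  refine ⟨max β₀ 0, fun β hβ L hL hδ => ?_⟩
  have hβ0 : 0 ≤ β := (le_max_right _ _).trans hβ
  have hq : coldDefect r.ρ β (4 * L) ≤ 10600 * θ ^ 4 := by
    have hS := axisSymmetric r β
    have hT := tracePositive r hβ0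
    rw [coldDefect_eq_boxDefect] at hδ ⊢
    exact basin_step24 hS hT L hL hδ hθ24
  have h4 := h β ((le_max_left _ _).trans hβ) (4 * L) (by omega) ⟨2 * L, by ring⟩ hq
  have h5 : (4 * L / 4 : ℕ) = L := by omega
  rwa [h5] at h4

/-- **SELECTOR GROWTH on even selectors (PROVED):** any exit selector `β ↦ L(β)` of `E(θ)`, `θ < (1 − ρ)/2`, is eventually ODD or has
`⌊L(β)/4⌋ > ℓ(β)`. -/
theorem selector_outgrows_even (r : LatticeRep G) {c : G} {μ : Fin 4} {ℓ : ℝ → ℝ} {ρ : ℝ}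
    (hB : PurityTwistBoundAt r c μ) (hW : TwistWindowBelow r c μ ℓ ρ) {θ : ℝ} (hθ : θ < (1 - ρ) / 2)
    (Lsel : ℝ → ℕ) (h8 : ∀ᶠ β : ℝ in atTop, 8 ≤ Lsel β) (hpure : ∀ᶠ β : ℝ in atTop, coldDefect r.ρ β (Lsel β) ≤ θ) :
    ∀ᶠ β : ℝ in atTop, Even (Lsel β) → ℓ β < ((Lsel β / 4 : ℕ) : ℝ) := by
  obtain ⟨β₀, hβ₀⟩ := pure_even_box_is_long r hB hW hθ
  filter_upwards [h8, hpure, eventually_ge_atTop β₀] with β hβ8 hβp hβ0 hE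
  exact hβ₀ β hβ0 (Lsel β) hβ8 hE hβp

/-- **SELECTOR GROWTH, ALL PARITIES, at tolerance `θ ≤ 1/24` (PROVED):** every exit selector of `E(θ)` has `L(β) > ℓ(β)` eventually. -/
theorem selector_outgrows_all (r : LatticeRep G) {c : G} {μ : Fin 4} {ℓ : ℝ → ℝ} {ρ : ℝ}
    (hB : PurityTwistBoundAt r c μ) (hW : TwistWindowBelow r c μ ℓ ρ) {θ : ℝ} (hθ24 : θ ≤ 1 / 24)
    (hθρ : 10600 * θ ^ 4 < (1 - ρ) / 2)
    (Lsel : ℝ → ℕ) (h8 : ∀ᶠ β : ℝ in atTop, 8 ≤ Lsel β) (hpure : ∀ᶠ β : ℝ in atTop, coldDefect r.ρ β (Lsel β) ≤ θ) :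
    ∀ᶠ β : ℝ in atTop, ℓ β < (Lsel β : ℝ) := by
  obtain ⟨β₀, hβ₀⟩ := pure_box_is_long_all r hB hW hθ24 hθρ
  filter_upwards [h8, hpure, eventually_ge_atTop β₀] with β hβ8 hβp hβ0
  exact hβ₀ β hβ0 (Lsel β) hβ8 hβp

/-- **No β-uniform witness, parity-free, at tolerance `θ ≤ 1/24` (PROVED from S1 + any DIVERGENT window):** `¬ UniformExitAtRep r θ`. -/
theorem not_uniformExitAtRep_of_window (r : LatticeRep G) {c : G} {μ : Fin 4} {ℓ : ℝ → ℝ} {ρ : ℝ}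
    (hB : PurityTwistBoundAt r c μ) (hW : TwistWindowBelow r c μ ℓ ρ) (hℓ : Tendsto ℓ atTop atTop)
    {θ : ℝ} (hθ24 : θ ≤ 1 / 24) (hθρ : 10600 * θ ^ 4 < (1 - ρ) / 2) : ¬ UniformExitAtRep r θ := by
  rintro ⟨L, hL, β₁, h⟩
  obtain ⟨β₀, hβ₀⟩ := pure_box_is_long_all r hB hW hθ24 hθρ
  obtain ⟨β, hℓL, hβ0, hβ1⟩ :=
    ((hℓ.eventually_ge_atTop (L : ℝ)).and ((eventually_ge_atTop β₀).and (eventually_ge_atTop β₁))).exists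
  have := hβ₀ β hβ0 L hL (h β hβ1)
  linarith

/-- The β-uniform witness on an EVEN box (for tolerances `1/24 < θ < (1 − ρ)/2`, where only reflection positivity speaks). -/
def UniformEvenExitAtRep (r : LatticeRep G) (θ : ℝ) : Prop :=
  ∃ L : ℕ, 8 ≤ L ∧ Even L ∧ ∃ β₁ : ℝ, ∀ β : ℝ, β₁ ≤ β → coldDefect r.ρ β L ≤ θ

/-- **No β-uniform EVEN witness for `θ < (1 − ρ)/2` (PROVED from S1 + any divergent window).** -/
theorem not_uniformEvenExitAtRep_of_window (r : LatticeRep G) {c : G} {μ : Fin 4} {ℓ : ℝ → ℝ} {ρ : ℝ}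
    (hB : PurityTwistBoundAt r c μ) (hW : TwistWindowBelow r c μ ℓ ρ) (hℓ : Tendsto ℓ atTop atTop)
    {θ : ℝ} (hθ : θ < (1 - ρ) / 2) : ¬ UniformEvenExitAtRep r θ := by
  rintro ⟨L, hL, hE, β₁, h⟩
  obtain ⟨β₀, hβ₀⟩ := pure_even_box_is_long r hB hW hθ
  obtain ⟨β, hℓL, hβ0, hβ1⟩ :=
    ((hℓ.eventually_ge_atTop (((L / 4 : ℕ) : ℝ))).and ((eventually_ge_atTop β₀).and (eventually_ge_atTop β₁))).exists
  have := hβ₀ β hβ0 L hL hE (h β hβ1)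
  linarith

/-- **LINEAR SELECTOR GROWTH, even selectors (PROVED):** `θ < (1 − ρ)/2` ⇒ eventually `L(β)` odd or `L(β) > 4β/κ`. -/
theorem selector_linear_growth_even (r : LatticeRep G) {c : G} {μ : Fin 4} {κ ρ : ℝ}
    (hB : PurityTwistBoundAt r c μ) (hW : TwistWindowAt r c μ κ ρ) {θ : ℝ} (hθ : θ < (1 - ρ) / 2)
    (Lsel : ℝ → ℕ) (h8 : ∀ᶠ β : ℝ in atTop, 8 ≤ Lsel β) (hpure : ∀ᶠ β : ℝ in atTop, coldDefect r.ρ β (Lsel β) ≤ θ) :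
    ∀ᶠ β : ℝ in atTop, Even (Lsel β) → 4 * β / κ < (Lsel β : ℝ) := by
  filter_upwards [selector_outgrows_even r hB (twistWindowBelow_of_at r hW) hθ Lsel h8 hpure] with β hβ hE
  have h1 : β / κ < ((Lsel β / 4 : ℕ) : ℝ) := hβ hE
  have h2 : ((Lsel β / 4 : ℕ) : ℝ) ≤ (Lsel β : ℝ) / 4 := Nat.cast_div_le
  have h3 : 4 * β / κ = 4 * (β / κ) := by ring
  rw [h3]
  linarith

/-- **LINEAR SELECTOR GROWTH, ALL PARITIES, at `θ ≤ 1/24` (PROVED):** `L(β) > β/κ` eventually — no parity escape. -/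
theorem selector_linear_growth_all (r : LatticeRep G) {c : G} {μ : Fin 4} {κ ρ : ℝ}
    (hB : PurityTwistBoundAt r c μ) (hW : TwistWindowAt r c μ κ ρ) {θ : ℝ} (hθ24 : θ ≤ 1 / 24)
    (hθρ : 10600 * θ ^ 4 < (1 - ρ) / 2)
    (Lsel : ℝ → ℕ) (h8 : ∀ᶠ β : ℝ in atTop, 8 ≤ Lsel β) (hpure : ∀ᶠ β : ℝ in atTop, coldDefect r.ρ β (Lsel β) ≤ θ) :
    ∀ᶠ β : ℝ in atTop, β / κ < (Lsel β : ℝ) :=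
  selector_outgrows_all r hB (twistWindowBelow_of_at r hW) hθ24 hθρ Lsel h8 hpure

end Rung2

/-- **RUNG 2 input at class level `SU(2)` — SHAPE OF RECORD** (twist `−1`, `(0,3)`-planes, EVEN boxes): the linear deconfinement twist window
with slope `κ` and threshold `ρ`; expected instance `TwistWindowSU2 204 (9/10)` (crit-3 / idea-2 O10 constants: `f = (1 + 4/β)^{⌊L/4⌋} − 1 ≤ 1/50` on
`204·⌊L/4⌋ ≤ β`, `η ≥ 1/20`, `|r| ≤ 9/10`).  Why it might fail: it should not — every analytic input is a tree theorem (Borgs–Seiler finite-volume IR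
bound + diagonal bound) or abstractly proved (sectorCS, S1); the risk is the typed debts D1/D2/D4 (dictionaries, two-direction transfer reading).
Sources: BorgsSeiler1983 (doi:10.1007/bf01208780) Lemma II.6–II.8, Thm III.4 (III.16); tree `Literature.Barriers.QuantumFields.BorgsSeilerInfraredBoundExplicit_holds`,
`BorgsSeilerPolyakovDiagonal_holds`; idea-2 O10 (`O10SectorLRO.lean` e3cb8029558e); TomboulisYaffe1985 (doi:10.1007/bf01206134). -/
def TwistWindowSU2 (κ ρ : ℝ) : Prop :=
  letI : MeasurableSpace (Matrix.specialUnitaryGroup (Fin 2) ℂ) := borel _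
  haveI : BorelSpace (Matrix.specialUnitaryGroup (Fin 2) ℂ) := ⟨rfl⟩
  TwistWindowAt (fundamentalLatticeRep 2) minusOneSU2 0 κ ρ

/-- The numbers of record clear the quadrupling: `10600·(1/24)⁴ ≈ 0.0320 < 0.05 = (1 − 9/10)/2` (PROVED). -/
theorem tolerance_of_record_clears : (10600 : ℝ) * (1 / 24) ^ 4 < (1 - 9 / 10) / 2 := by norm_num

/-- **RUNG 2 at `SU(2)`, even selectors (PROVED mod S1 + window):** `θ < (1 − ρ)/2` ⇒ every exit selector of the `SU(2)`-fundamental instance of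
`E(θ)` is eventually odd or `> 4β/κ`. -/
theorem selector_linear_growth_SU2_even {κ ρ : ℝ} (hB : PurityTwistBoundSU2) (hW : TwistWindowSU2 κ ρ) {θ : ℝ}
    (hθ : θ < (1 - ρ) / 2) (Lsel : ℝ → ℕ) (h8 : ∀ᶠ β : ℝ in atTop, 8 ≤ Lsel β)
    (hpure : letI : MeasurableSpace (Matrix.specialUnitaryGroup (Fin 2) ℂ) := borel _
      haveI : BorelSpace (Matrix.specialUnitaryGroup (Fin 2) ℂ) := ⟨rfl⟩
      ∀ᶠ β : ℝ in atTop, coldDefect (fundamentalLatticeRep 2).ρ β (Lsel β) ≤ θ) :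
    ∀ᶠ β : ℝ in atTop, Even (Lsel β) → 4 * β / κ < (Lsel β : ℝ) := by
  letI : MeasurableSpace (Matrix.specialUnitaryGroup (Fin 2) ℂ) := borel _
  haveI : BorelSpace (Matrix.specialUnitaryGroup (Fin 2) ℂ) := ⟨rfl⟩
  exact selector_linear_growth_even (fundamentalLatticeRep 2) hB hW hθ Lsel h8 hpure

/-- **RUNG 2 at `SU(2)`, ALL PARITIES, at the tolerance of record (PROVED mod S1 + window):** for `θ ≤ 1/24` with `10600θ⁴ < (1 − ρ)/2`
(e.g. `θ = 1/24`, `ρ = 9/10`), every exit selector of `E(θ)`'s `SU(2)` instance has `L(β) > β/κ` eventually. -/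
theorem selector_linear_growth_SU2 {κ ρ : ℝ} (hB : PurityTwistBoundSU2) (hW : TwistWindowSU2 κ ρ) {θ : ℝ}
    (hθ24 : θ ≤ 1 / 24) (hθρ : 10600 * θ ^ 4 < (1 - ρ) / 2) (Lsel : ℝ → ℕ) (h8 : ∀ᶠ β : ℝ in atTop, 8 ≤ Lsel β)
    (hpure : letI : MeasurableSpace (Matrix.specialUnitaryGroup (Fin 2) ℂ) := borel _
      haveI : BorelSpace (Matrix.specialUnitaryGroup (Fin 2) ℂ) := ⟨rfl⟩
      ∀ᶠ β : ℝ in atTop, coldDefect (fundamentalLatticeRep 2).ρ β (Lsel β) ≤ θ) :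
    ∀ᶠ β : ℝ in atTop, β / κ < (Lsel β : ℝ) := by
  letI : MeasurableSpace (Matrix.specialUnitaryGroup (Fin 2) ℂ) := borel _
  haveI : BorelSpace (Matrix.specialUnitaryGroup (Fin 2) ℂ) := ⟨rfl⟩
  exact selector_linear_growth_all (fundamentalLatticeRep 2) hB hW hθ24 hθρ Lsel h8 hpure

/-- **THE WALL THEOREM SHAPE, parity-free at the tolerance of record (PROVED mod S1 + window; `π₁(SU(2)) = 1` carried as a hypothesis):**
`PurityTwistBoundSU2 → TwistWindowSU2 κ ρ → θ ≤ 1/24 → 10600θ⁴ < (1 − ρ)/2 → ¬ UniformExitAt θ`.  For the wall seat: with `TwistWindowSU2 204 (9/10)`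
and S1 by name this is UNCONDITIONAL and needs no «even boxes» proviso. -/
theorem not_uniformExitAt_of_windowSU2 {κ ρ : ℝ} (hB : PurityTwistBoundSU2) (hW : TwistWindowSU2 κ ρ)
    (hsc : SimplyConnectedSpace (Matrix.specialUnitaryGroup (Fin 2) ℂ)) {θ : ℝ} (hθ24 : θ ≤ 1 / 24)
    (hθρ : 10600 * θ ^ 4 < (1 - ρ) / 2) : ¬ UniformExitAt θ := by
  intro hU
  have hG : IsCompactSimpleLieGroup (Matrix.specialUnitaryGroup (Fin 2) ℂ) :=
    isCompactSimpleLieGroup_specialUnitaryGroup isSimpleCompactGroup_specialUnitaryGroup_holds le_rfl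
  letI : MeasurableSpace (Matrix.specialUnitaryGroup (Fin 2) ℂ) := borel _
  haveI : BorelSpace (Matrix.specialUnitaryGroup (Fin 2) ℂ) := ⟨rfl⟩
  have hUr : UniformExitAtRep (fundamentalLatticeRep 2) θ := hU _ hG hsc (fundamentalLatticeRep 2)
  have hW' : TwistWindowAt (fundamentalLatticeRep 2) minusOneSU2 0 κ ρ := hW
  have hℓ : Tendsto (fun β : ℝ => β / κ) atTop atTop := tendsto_id.atTop_div_const hW'.1
  exact not_uniformExitAtRep_of_window (fundamentalLatticeRep 2) hB (twistWindowBelow_of_at _ hW') hℓ hθ24 hθρ hUr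

/-- **Headline at the tolerance of record (PROVED mod S1 + `TwistWindowSU2 κ (9/10)`): `¬ UniformExit24`, parity-free.** -/
theorem not_uniformExit24_of_windowSU2 {κ : ℝ} (hB : PurityTwistBoundSU2) (hW : TwistWindowSU2 κ (9 / 10))
    (hsc : SimplyConnectedSpace (Matrix.specialUnitaryGroup (Fin 2) ℂ)) : ¬ UniformExit24 :=
  not_uniformExitAt_of_windowSU2 hB hW hsc le_rfl (by norm_num)

/-! ## §5b WINDOW-ONLY COROLLARIES (S1 is a theorem): RUNG 2 needs only the window (+ `π₁(SU(2)) = 1` as hypothesis) -/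

/-- **RUNG 2, S1-free: the deconfinement twist window ALONE (+ `π₁`) refutes `UniformExitAt θ` parity-free for `θ ≤ 1/24`, `10600·θ⁴ < (1 − ρ)/2`.** -/
theorem not_uniformExitAt_of_window {κ ρ : ℝ} (hW : TwistWindowSU2 κ ρ)
    (hsc : SimplyConnectedSpace (Matrix.specialUnitaryGroup (Fin 2) ℂ)) {θ : ℝ} (hθ24 : θ ≤ 1 / 24)
    (hθρ : 10600 * θ ^ 4 < (1 - ρ) / 2) : ¬ UniformExitAt θ :=
  not_uniformExitAt_of_windowSU2 purityTwistBoundSU2_holds hW hsc hθ24 hθρ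

/-- **RUNG 2 at the tolerance of record, S1-free: `TwistWindowSU2 κ (9/10)` (+ `π₁`) ⇒ `¬ UniformExit24`** — the №24 wall seat's headline needs ONLY the window. -/
theorem not_uniformExit24_of_window {κ : ℝ} (hW : TwistWindowSU2 κ (9 / 10))
    (hsc : SimplyConnectedSpace (Matrix.specialUnitaryGroup (Fin 2) ℂ)) : ¬ UniformExit24 :=
  not_uniformExit24_of_windowSU2 purityTwistBoundSU2_holds hW hsc

/-- **Linear selector growth, S1-free, all parities:** window ⇒ every exit selector of `E(θ)` (`θ ≤ 1/24`, `10600θ⁴ < (1−ρ)/2`) at `SU(2)` has `L(β) > β/κ` eventually. -/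
theorem selector_linear_growth_of_window {κ ρ : ℝ} (hW : TwistWindowSU2 κ ρ) {θ : ℝ} (hθ24 : θ ≤ 1 / 24)
    (hθρ : 10600 * θ ^ 4 < (1 - ρ) / 2) (Lsel : ℝ → ℕ) (h8 : ∀ᶠ β : ℝ in atTop, 8 ≤ Lsel β)
    (hpure : letI : MeasurableSpace (Matrix.specialUnitaryGroup (Fin 2) ℂ) := borel _
      haveI : BorelSpace (Matrix.specialUnitaryGroup (Fin 2) ℂ) := ⟨rfl⟩
      ∀ᶠ β : ℝ in atTop, coldDefect (fundamentalLatticeRep 2).ρ β (Lsel β) ≤ θ) :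
    ∀ᶠ β : ℝ in atTop, β / κ < (Lsel β : ℝ) :=
  selector_linear_growth_SU2 purityTwistBoundSU2_holds hW hθ24 hθρ Lsel h8 hpure

end Summit.QuantumFields.YangMills.Theorems.ColdExitSC.Negative.HeavyTwist
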